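import Literature.IUT.HodgeArakelov.CohomologyLimitConj
import Literature.AnabelianGeometry.EtaleTheta.ContH1CoeffChange

/-!
# Pull-back of the cohomology limit `lim_K H¹(H|_K, A)` along a continuous homomorphism `ι : Π₀ → Π`
# (restriction to a decomposition group with its OWN conjugation action), and the conjugation action as a
# homomorphism into `MulAut`

Companion (abc-iut cell, layer L6, seat abc-iut-w4-d004 gen 2; node IUTchII:Cor3.5(ii), junction hypothesis
`hr` of `BadPrimeGaussianMonoidsSyncProofs` / `…SyncMonoidProofs`) to abc-iut-L6-t1's
`CohomologySystemOfContH1.lean` (the [IUTchII] Prop. 1.4 interface instantiated from L2's continuous `H¹`),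
abc-iut-w4-d043's `CohomologyLimitConj.lean` (the conjugation action `h1LimConj` on the limit, `H ⊴ Π`) and
`CohomologyLimitRestriction.lean` (restriction to `D ≤ H` inside the SAME ambient group). S. Mochizuki,
*Inter-universal Teichmüller theory II*, kurims manuscript (Dec. 2020), Cor. 2.8 (i) p. 82: "restriction … to the
decomposition groups `D^δ_{t,μ_-}` … yield[s] `μ_{2l}`-, `μ`-orbits of elements
`θ^t_env ⊆ ∞θ^t_env ⊆ lim_{J_G} H¹(G_v(…)|_{J_G}, Π_μ(…))`"; Cor. 3.5 (ii) p. 95: "the compatibility of the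
action of `G_v(M^Θ_*▶)_{|t|}` on the factor labeled `|t|` … with the inclusions `G_v(M^Θ_*) ↪ Π_{v▶}(M^Θ_*▶)`
determined by the various choices of the `D^δ_{t,μ_-}`" [cite: Mochizuki2012, Cor 3.5 (ii) p.95]. The target of
that restriction is the cohomology OF THE DECOMPOSITION GROUP with ITS OWN conjugation action (the labeled
`G_v`-action); since L2's `ContH1.conj` requires the level subgroup to be normal in the AMBIENT group, the
decomposition group `D ≅ G_v` (not normal in `Π`) must be treated as its own ambient topological group `Π₀`, the
restriction being the PULL-BACK along the inclusion `ι : Π₀ = D ↪ Π` — functoriality of `H¹` in the group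
(L2 `ContH1.comap`, abc-iut-L2 `ContH1CoeffChange.lean`) assembled on the limits:
* `CohomologySystemOfContH1.Idx.comap` — the index `ι⁻¹(K)` (finite-index, open) of the `Π₀`-system under the
  index `K` of the `Π`-system;
* `gmodComap`, `h1LimComap ι : lim_K H¹(H ⊓ K, A) → lim_{K₀} H¹(H₀ ⊓ K₀, A)` for `ι(H₀) ≤ H`, the action of `Π₀`
  on `A` being through `φ ∘ ι` (DEFINED by the universal property; `h1LimComap_of` on generators);
* `h1LimComap_conj` — **the pull-back intertwines the conjugation actions**: `ι^*(conj_{ι σ} y) = conj_σ (ι^* y)`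
  (`H₀ ⊴ Π₀`, `H ⊴ Π`; from L2's `ContH1.comap_conj` at the normal cores) — the cohomological content of the
  junction hypothesis `hr` of [IUTchII] Cor 3.5 (ii);
* `h1LimConjMulAut : Π →* MulAut (Multiplicative lim)` — abc-iut-w4-d043's action `h1LimConj`/`h1LimConjEquiv`
  packaged as a homomorphism into `MulAut` of the multiplicatively written limit (the shape of
  `TemperedThetaMonoids.ThetaEnvData.conj : Π →* MulAut H` of abc-iut-L6-t2's statement file), with
  `h1LimConjMulAut_apply`.
Elementary (Neukirch–Schmidt–Wingberg I §5 functoriality [cite: NeukirchSchmidtWingberg2008, I §5]); a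
construction over Mathlib + the landed files; nothing of [IUTchII] is asserted (claim key of the interface
`Mochizuki2012`, D-0012 disputed; no side taken on [IUTchIII] Cor. 3.12).
-/

namespace Literature.IUT.HodgeArakelov

open Literature.AnabelianGeometry.EtaleTheta CohomologySystemOfContH1

universe u

noncomputable section

variable {P₀ P : TopGroup.{u}} {G' : Type u} [Group G'] [TopologicalSpace G'] [IsTopologicalGroup G']
  (φ : P →* G') (A : Subgroup G') [A.Normal] [IsMulCommutative A]
  (ι : P₀ →* P) (hι : Continuous ι) {H₀ : Subgroup P₀} {H : Subgroup P}

namespace CohomologySystemOfContH1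

/-- The index `ι⁻¹(K)` of the system over `Π₀` determined by an index `K` (finite-index open subgroup of `Π`)
of the system over `Π`: `ι⁻¹(K)` is open (continuity of `ι`) and of finite index (`[Π₀ : ι⁻¹K] = [ι(Π₀) : ι(Π₀) ∩ K]`).
[cite: NeukirchSchmidtWingberg2008, I §5] -/
def Idx.comap (i : Idx (P := P) ⊥) : Idx (P := P₀) ⊥ :=
  OrderDual.toDual
    ⟨(i.K).comap ι,
      (by
        haveI := (OrderDual.ofDual i).2.1
        rw [Subgroup.finiteIndex_iff, Subgroup.index_comap]
        exact Subgroup.FiniteIndex.index_ne_zero),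
      (OrderDual.ofDual i).2.2.1.preimage hι,
      bot_le⟩

/-- The subgroup of the pulled-back index is `ι⁻¹(K)`. [cite: NeukirchSchmidtWingberg2008, I §5] -/
@[simp] theorem Idx.comap_K (i : Idx (P := P) ⊥) : (Idx.comap ι hι i).K = (i.K).comap ι := rfl

/-- `Idx.comap` is monotone (`K_j ≤ K_i ⇒ ι⁻¹K_j ≤ ι⁻¹K_i`). [cite: NeukirchSchmidtWingberg2008, I §5] -/
theorem Idx.comap_mono {i j : Idx (P := P) ⊥} (hij : i ≤ j) : Idx.comap ι hι i ≤ Idx.comap ι hι j :=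
  Idx.le_iff.mpr (Subgroup.comap_mono (Idx.le_iff.mp hij))

/-- `ι(H₀ ∩ ι⁻¹K) ≤ H ∩ K` when `ι(H₀) ≤ H`. [cite: NeukirchSchmidtWingberg2008, I §5] -/
theorem inf_comap_map_le (hH : H₀.map ι ≤ H) (i : Idx (P := P) ⊥) :
    (H₀ ⊓ (Idx.comap ι hι i).K).map ι ≤ H ⊓ i.K := by
  rintro _ ⟨x, hx, rfl⟩
  exact ⟨hH ⟨x, hx.1, rfl⟩, hx.2⟩

/-- `H₀ ∩ ι⁻¹K` is normal in `Π₀` when `H₀ ⊴ Π₀` and `K ⊴ Π`. [cite: NeukirchSchmidtWingberg2008, I §5] -/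
theorem inf_comap_normal [H₀.Normal] (i : Idx (P := P) ⊥) [(i.K).Normal] :
    (H₀ ⊓ (Idx.comap ι hι i).K).Normal := by
  haveI : ((i.K).comap ι).Normal := Subgroup.Normal.comap inferInstance ι
  exact Subgroup.normal_inf_normal H₀ ((i.K).comap ι)

end CohomologySystemOfContH1

variable (hH : H₀.map ι ≤ H)

/-- Pull-back `H¹(H ⊓ K, A) → H¹(H₀ ⊓ ι⁻¹K, A)` on the members of the two systems (L2 `ContH1.comap` along `ι`,
the action of `Π₀` on `A` being through `φ ∘ ι`). [cite: NeukirchSchmidtWingberg2008, I §5] -/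
def gmodComap (i : Idx (P := P) ⊥) : Gmod φ A H ⊥ i →+ Gmod (φ.comp ι) A H₀ ⊥ (Idx.comap ι hι i) :=
  MonoidHom.toAdditive (ContH1.comap φ A ι hι (inf_comap_map_le ι hι hH i))

/-- The member-wise pull-backs commute with the transition (restriction) maps of the two systems.
[cite: NeukirchSchmidtWingberg2008, I §5] -/
theorem gmodComap_fmod {i j : Idx (P := P) ⊥} (hij : i ≤ j) (x : Gmod φ A H ⊥ i) :
    gmodComap φ A ι hι hH j (fmod φ A H ⊥ i j hij x) =
      fmod (φ.comp ι) A H₀ ⊥ (Idx.comap ι hι i) (Idx.comap ι hι j) (Idx.comap_mono ι hι hij)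
        (gmodComap φ A ι hι hH i x) :=
  congrArg Additive.ofMul
    (ContH1.res_comap φ A ι hι (inf_comap_map_le ι hι hH i) (inf_comap_map_le ι hι hH j)
      (inf_le_inf_left H₀ (Idx.le_iff.mp (Idx.comap_mono ι hι hij))) (inf_le_inf_left H (Idx.le_iff.mp hij))
      (Additive.toMul x)).symm

/-- **Pull-back of the limits** `lim_K H¹(H ⊓ K, A) → lim_{K₀} H¹(H₀ ⊓ K₀, A)` along `ι : Π₀ → Π` with
`ι(H₀) ≤ H` (DEFINED by the universal property of the direct limit: the member at `K` goes to the member at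
`ι⁻¹K`). For `ι` the inclusion of a decomposition group `D ≤ H` regarded as its own ambient group this is the
restriction `lim_J H¹(Π_Ÿ|_J, −) → lim_{J_G} H¹(G_v|_{J_G}, −)` of [IUTchII] Cor. 2.8 (i) / Cor. 3.5 (levels
`D ∩ K`, `K` finite-index open in `Π`). [cite: Mochizuki2012, Cor 3.5 (ii) p.95] -/
def h1LimComap : h1Lim φ A H ⊥ →+ h1Lim (φ.comp ι) A H₀ ⊥ :=
  AddCommGroup.DirectLimit.lift (Gmod φ A H ⊥) (fmod φ A H ⊥) (h1Lim (φ.comp ι) A H₀ ⊥)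
    (fun i => (h1Of (φ.comp ι) A H₀ ⊥ (Idx.comap ι hι i)).comp (gmodComap φ A ι hι hH i))
    (fun i j hij x => by
      change h1Of (φ.comp ι) A H₀ ⊥ (Idx.comap ι hι j) (gmodComap φ A ι hι hH j (fmod φ A H ⊥ i j hij x)) =
        h1Of (φ.comp ι) A H₀ ⊥ (Idx.comap ι hι i) (gmodComap φ A ι hι hH i x)
      rw [gmodComap_fmod, h1Of_fmod])

/-- `h1LimComap` on generators. [cite: NeukirchSchmidtWingberg2008, I §5] -/
@[simp] theorem h1LimComap_of (i : Idx (P := P) ⊥) (x : Gmod φ A H ⊥ i) :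
    h1LimComap φ A ι hι hH (h1Of φ A H ⊥ i x) =
      h1Of (φ.comp ι) A H₀ ⊥ (Idx.comap ι hι i) (gmodComap φ A ι hι hH i x) :=
  AddCommGroup.DirectLimit.lift_of (G := Gmod φ A H ⊥) (f := fmod φ A H ⊥) _ _ _ i x

/-- **The pull-back intertwines the conjugation actions** (`H₀ ⊴ Π₀`, `H ⊴ Π`): for `σ ∈ Π₀`,
`ι^* (conj_{ι σ} y) = conj_σ (ι^* y)` on the limits — functoriality of `H¹` with respect to the pair
`(ι, conj)`; computed at the normal cores of the indices via L2's `ContH1.comap_conj`. This is the equivariance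
"`r_t (conj (s_t g) x) = β_g (r_t x)`" (hypothesis `hr` of [IUTchII] Cor 3.5 (ii) in
`BadPrimeGaussianMonoidsSyncProofs`) for restriction to a decomposition group along its inclusion.
[cite: Mochizuki2012, Cor 3.5 (ii) p.95] -/
theorem h1LimComap_conj [H₀.Normal] [H.Normal] (σ : P₀) (y : h1Lim φ A H ⊥) :
    h1LimComap φ A ι hι hH (h1LimConj φ A H (ι σ) y) =
      h1LimConj (φ.comp ι) A H₀ σ (h1LimComap φ A ι hι hH y) := by
  have key : (h1LimComap φ A ι hι hH).comp (h1LimConj φ A H (ι σ)) =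
      (h1LimConj (φ.comp ι) A H₀ σ).comp (h1LimComap φ A ι hι hH) := by
    refine h1Lim_hom_ext φ A H fun i x => ?_
    haveI : (H₀ ⊓ (Idx.comap ι hι i.core).K).Normal := inf_comap_normal ι hι i.core
    change h1LimComap φ A ι hι hH (h1LimConj φ A H (ι σ) (h1Of φ A H ⊥ i x)) =
      h1LimConj (φ.comp ι) A H₀ σ (h1LimComap φ A ι hι hH (h1Of φ A H ⊥ i x))
    rw [← h1Of_fmod φ A H ⊥ i.le_core x, h1LimConj_of_normal φ A H (ι σ) i.core, h1LimComap_of,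
      h1LimComap_of, h1LimConj_of_normal (φ.comp ι) A H₀ σ (Idx.comap ι hι i.core)]
    exact congrArg (h1Of (φ.comp ι) A H₀ ⊥ (Idx.comap ι hι i.core))
      (congrArg Additive.ofMul
        (ContH1.comap_conj φ A ι hι (inf_comap_map_le ι hι hH i.core) σ
          (Additive.toMul (fmod φ A H ⊥ i i.core i.le_core x))))
  exact DFunLike.congr_fun key y

/-! ### The conjugation action as a homomorphism into `MulAut` -/

section MulAut

variable (H : Subgroup P) [H.Normal]

/-- **The conjugation ACTION of `Π` on `lim_K H¹(H|_K, A)`** (abc-iut-w4-d043 `h1LimConj`, an action by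
`h1LimConj_one` / `h1LimConj_mul`) packaged as a homomorphism `Π →* MulAut (Multiplicative lim)` — the shape of
the datum `ThetaEnvData.conj : Π_X(M^Θ_*) →* MulAut H` of [IUTchII] Prop 3.1 ("equipped with a natural
conjugation action by `Π_X(M^Θ_*)`", kurims p. 88). [cite: Mochizuki2012, Prop 3.1 (ii) p.88] -/
def h1LimConjMulAut : P →* MulAut (Multiplicative (h1Lim φ A H ⊥)) where
  toFun σ := AddEquiv.toMultiplicative (h1LimConjEquiv φ A H σ)
  map_one' := by
    ext x
    change Multiplicative.ofAdd (h1LimConj φ A H (1 : P) (Multiplicative.toAdd x)) = x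
    rw [h1LimConj_one_apply]
    rfl
  map_mul' σ τ := by
    ext x
    change Multiplicative.ofAdd (h1LimConj φ A H (σ * τ) (Multiplicative.toAdd x)) =
      Multiplicative.ofAdd (h1LimConj φ A H σ
        (Multiplicative.toAdd (Multiplicative.ofAdd (h1LimConj φ A H τ (Multiplicative.toAdd x)))))
    rw [h1LimConj_mul_apply]
    rfl

/-- `h1LimConjMulAut σ` is `h1LimConj σ` read multiplicatively. [cite: Mochizuki2012, Prop 3.1 (ii) p.88] -/
@[simp] theorem h1LimConjMulAut_apply (σ : P) (x : Multiplicative (h1Lim φ A H ⊥)) :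
    h1LimConjMulAut φ A H σ x = Multiplicative.ofAdd (h1LimConj φ A H σ (Multiplicative.toAdd x)) := rfl

/-- … equivalently, on additive elements. [cite: Mochizuki2012, Prop 3.1 (ii) p.88] -/
theorem toAdd_h1LimConjMulAut_ofAdd (σ : P) (y : h1Lim φ A H ⊥) :
    Multiplicative.toAdd (h1LimConjMulAut φ A H σ (Multiplicative.ofAdd y)) = h1LimConj φ A H σ y := rfl

end MulAut

end

end Literature.IUT.HodgeArakelov
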